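import Summits.QuantumFields.YangMills.Theorems.UnitScaleTiltProp8FlatHWholeBridge
import Summits.QuantumFields.YangMills.Theorems.UnitScaleTiltProp8FlatOpsFromKernelRows
import Literature.MathematicalPhysics.QuantumFieldTheory.Balaban1983to89.B5Hk163TorusHolderRate
import Literature.MathematicalPhysics.QuantumFieldTheory.Balaban1983to89.B5Ineq110P12Lattice
import HarnessLib

/-!
# Route `UnitScaleTilt`, crux K1 child «MinimiserStabilityRegPr» (stmt-QuantumFields-19200), v8 pillar **P2 `stub_flatOpsCubeSeq`** — OWNER RULING g21-№4 §B3(a)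
# one-level target, CLOSING FILE: **AT THE ONE-LEVEL FAMILY `Domains.whole (K − n)` THE INPUT ROW LIST `FlatOpsLettersAssembly.RowsAt` OF P2 HOLDS — WITH THE
# PHYSICAL DISTANCE `distBI`, p1 g14's constants and EXPLICIT (162) row-sum constant — MODULO EXACTLY THE TWO SECOND-ORDER KERNEL ROWS (k3), (k4) OF `H`**
# ([Balaban1985Variational] (130), (139)–(140) at `U = 1`; C-B11-F1: not in the one-level menu)

Cell `ym3-torus` (HUMAN RULING D-0037, YM ladder rung R3), seat `ym3-torus-p1` gen 16.  `--supports stmt-QuantumFields-19200 --as helper`; count-neutral; def-free.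

WHAT IS PROVED (sorry-free; axioms standard; no definition).
* §1 `exp_mul_add_one_le` — `e^{−½δ₀t}(t + 1) ≤ (4/δ₀ + 1)e^{−¼δ₀t}` (`t ≥ 0`); **`rowSum162_whole`** — THE (162) ROW SUM AT THE ONE-LEVEL FAMILY with `dBI := distBI`: for every
  `δ₀ > 0`, `RowSum162 F n K (whole (K−n)) distBI w δ₀ (3·(4/δ₀ + 1)·K₃(δ₀/4))` (`K₃` = `B4Sect5Proof.latticeConst 3`, the uniform torus lattice-sum constant; the index bonds
  of `whole (K−n)` are the `3·|T^{(K−n)}|` top-level bonds, `distBI` = the sup circular distance of blocks; `B5Hk163TorusHolderRate.sum_exp_torusSupNorm_sub_rep_le`);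
* §2 **`rowsAt_whole_of_secondOrderRows`** — THE ONE-LEVEL WITNESS: if the canonical `flatH` of `whole (K−n)` satisfies the two second-order kernel rows (k3) `(L^{j(b)}η)³|∂^{η*}∂^η(flatH e_c)(b)|
  ≤ C′e^{−κd}` and (k4) `(L^{j(b)}η)²η⁻²|Δ(flatH e_c)(b)| ≤ C′e^{−κd}` at the rate `κ = κ₁₆₃(3)/3` over `d = distBI`, then `RowsAt F n K (whole (K−n)) w B₀ κ B₃ C_G 1` with explicit
  constants — from `FlatHWholeBridge.hKernelRows12_whole` ((k1), (k2)), §1 ((162)), `FlatDomainsCongr.gRows_whole` (the `G`-rows), `FlatCubeQContraction.qContrLetter_whole` (the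
  `Q`-row), assembled by `FlatOpsHRowsFromKernels.hRows_of_kernelRows`.
So the registered text's input at the small-torus / one-level case is EXACTLY the second-order regularity of `H` ([Balaban1985Variational] (130), (137)–(140), printed by
reference to [Balaban1985BackgroundPropagators] (3.42)) — every other row is a theorem there.  HONEST SCOPE: bookkeeping; NOT a claim about the mass gap.

References: T. Bałaban, CMP **102** (1985) 277–309 [Balaban1985Variational] (130) p.298, (139)–(140) p.299, (161)–(163) p.303; CMP **96** (1984) 223–250 [Balaban1984PropagatorsII]
(2.1) p.224, Cor. 2.8 p.249; CMP **95** (1984) 17–40 [Balaban1984PropagatorsI] (1.63)–(1.66) p.29, (1.115) p.36.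
-/

set_option autoImplicit false

noncomputable section

open scoped BigOperators

namespace Summit.QuantumFields.YangMills.Theorems.FlatRowsWhole

open Literature.MathematicalPhysics.QuantumFieldTheory.Balaban1983to89
open B6SectADomainsV1 (Domains)
open B6SectAOperatorsV1 (BondIdx dcE dcsE)
open B5Eq117TorusCarriers (Mk)
open B5Eq118OneStroke (iterBlockOf)
open B5Prop12FieldsLattice (distSite distSite_nonneg)
open B5Hk163TorusHolderDecay (MD163)
open B5Hk163Decay (MG163)
open B5Hk163Strip (kappa163)
open B4TorusKernel (periodConst)
open B4Sect5Proof (latticeConst)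
open T3ContinuumYM3Torus (T3Family)
open FlatCubeOpsText (distBI IsLevWeight RowSum162)
open FlatOpsLettersAssembly (flatH RowsAt)
open FlatOpsHRowsFromKernels (HKernelRows hRows_of_kernelRows)
open FlatDomainsCongr (sum_bondIdx_eq lamBond_whole_iff gRows_whole)
open FlatHWholeBridge (hKernelRows12_whole)
open FlatCubeQContraction (qContrLetter_whole)
open FlatMinimizerH (le_T3)

/-! ## §1 The (162) row sum at the one-level family -/

/-- `e^{−½δ₀t}(t + 1) ≤ (4/δ₀ + 1)·e^{−¼δ₀t}` for `t ≥ 0`, `δ₀ > 0`. [folklore] -/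
theorem exp_mul_add_one_le {δ₀ t : ℝ} (hδ₀ : 0 < δ₀) (ht : 0 ≤ t) :
    Real.exp (-(δ₀ / 2 * t)) * (t + 1) ≤ (4 / δ₀ + 1) * Real.exp (-(δ₀ / 4 * t)) := by
  have h1 : δ₀ / 4 * t + 1 ≤ Real.exp (δ₀ / 4 * t) := Real.add_one_le_exp _
  have h2 : 1 ≤ Real.exp (δ₀ / 4 * t) := Real.one_le_exp (by positivity)
  have ht' : t + 1 ≤ (4 / δ₀ + 1) * Real.exp (δ₀ / 4 * t) := by
    have : t = 4 / δ₀ * (δ₀ / 4 * t) := by field_simp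
    calc t + 1 = 4 / δ₀ * (δ₀ / 4 * t) + 1 := by rw [← this]
      _ ≤ 4 / δ₀ * Real.exp (δ₀ / 4 * t) + Real.exp (δ₀ / 4 * t) := by
          have h4 : 0 ≤ 4 / δ₀ := by positivity
          nlinarith
      _ = (4 / δ₀ + 1) * Real.exp (δ₀ / 4 * t) := by ring
  have hkey : Real.exp (-(δ₀ / 2 * t)) * ((4 / δ₀ + 1) * Real.exp (δ₀ / 4 * t)) = (4 / δ₀ + 1) * Real.exp (-(δ₀ / 4 * t)) := by
    rw [mul_left_comm, ← Real.exp_add]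
    congr 2
    ring
  calc Real.exp (-(δ₀ / 2 * t)) * (t + 1) ≤ Real.exp (-(δ₀ / 2 * t)) * ((4 / δ₀ + 1) * Real.exp (δ₀ / 4 * t)) :=
        mul_le_mul_of_nonneg_left ht' (Real.exp_pos _).le
    _ = (4 / δ₀ + 1) * Real.exp (-(δ₀ / 4 * t)) := hkey

/-- the uniform torus row sum: `Σ_{y ∈ T^{(j)}} e^{−a·dist_j(y₀, y)} ≤ K₃(a)`. [cite: Balaban1984PropagatorsI, (1.65)-(1.66) p.29] -/
theorem sum_exp_distSite_le (F : T3Family) (K j : ℕ) {a : ℝ} (ha : 0 < a) (y₀ : Site (F.P K) j) :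
    ∑ y : Site (F.P K) j, Real.exp (-(a * distSite (Mk (F.P K) j) y₀ y)) ≤ latticeConst 3 a := by
  have h := B5Hk163TorusHolderRate.sum_exp_torusSupNorm_sub_rep_le (Mk (F.P K) j) ha
    (B6LowerBound2153Torus.rep (Mk (F.P K) j) y₀)
  refine le_trans (le_of_eq (Finset.sum_congr rfl fun y _ => ?_)) h
  exact congrArg (fun t : ℝ => Real.exp (-(a * t))) (B5Ineq110P12Lattice.distSite_eq_torusSupNorm (Mk (F.P K) j) y₀ y)

/-- **THE (162) ROW SUM AT THE ONE-LEVEL FAMILY, PHYSICAL DISTANCE**: for `δ₀ > 0`, `RowSum162 F n K (whole (K−n)) distBI w δ₀ (3·(4/δ₀ + 1)·K₃(δ₀/4))` — the index bonds are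
the top-level bonds, the weights are `1`, `distBI` is the block distance, and the torus lattice sum is uniform. [cite: Balaban1985Variational, (162) p.303; Balaban1984PropagatorsI, (1.66) p.29] -/
theorem rowSum162_whole (F : T3Family) (n K : ℕ) {δ₀ : ℝ} (hδ₀ : 0 < δ₀) (w : ℕ → PBond (F.P K) 0 → ℝ)
    (hw : IsLevWeight F n K (Domains.whole (K - n) (le_T3 F n K)) w) :
    RowSum162 F n K (Domains.whole (K - n) (le_T3 F n K)) (fun b c => distBI (Domains.whole (K - n) (le_T3 F n K)) b c) w δ₀
      (3 * (4 / δ₀ + 1) * latticeConst 3 (δ₀ / 4)) := by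
  intro b
  classical
  set D : Domains (F.P K) := Domains.whole (K - n) (le_T3 F n K) with hD
  rw [FlatCubeOpsTextWhole.levWeight_whole_eq_one F n K (le_T3 F n K) w hw 1 b, one_mul]
  -- reindex the sum over the index bonds: only the level `K − n` survives
  set g : (j : ℕ) → PBond (F.P K) j → ℝ := fun j cb =>
    Real.exp (-(δ₀ / 2 * (((F.L : ℝ)⁻¹) ^ (D.k - j) * distSite (Mk (F.P K) j) (iterBlockOf j b.src) cb.src))) *
      (((F.L : ℝ)⁻¹) ^ (D.k - j) * distSite (Mk (F.P K) j) (iterBlockOf j b.src) cb.src + 1) * (F.L : ℝ) ^ ((K - n) - j) with hg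
  have hre : ∑ c : BondIdx D, Real.exp (-(δ₀ / 2 * distBI D b c)) * (distBI D b c + 1) * (F.L : ℝ) ^ ((K - n) - (c.1.1 : ℕ)) =
      ∑ c : BondIdx D, g c.1.1 c.1.2 := Finset.sum_congr rfl fun c _ => rfl
  rw [hre, sum_bondIdx_eq D g]
  have hlam : ∀ (j : ℕ) (cb : PBond (F.P K) j), (if D.LamBond j cb then g j cb else 0) = if j = K - n then g j cb else 0 :=
    fun j cb => by simp only [hD, lamBond_whole_iff (le_T3 F n K) j cb]
  simp only [hlam]
  rw [show (∑ j ∈ Finset.range ((F.P K).m + (F.P K).K + 1), ∑ cb : PBond (F.P K) j, if j = K - n then g j cb else 0) =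
      ∑ j ∈ Finset.range ((F.P K).m + (F.P K).K + 1), (if j = K - n then ∑ cb : PBond (F.P K) j, g j cb else 0) from
    Finset.sum_congr rfl fun j _ => by split_ifs <;> simp, Finset.sum_ite_eq']
  rw [if_pos (Finset.mem_range.2 (Nat.lt_succ_of_le (le_T3 F n K)))]
  -- the surviving level: `g (K−n) cb = e^{−½δ₀d}(d + 1)` with `d` the block distance
  have hDk : D.k = K - n := rfl
  have hg' : ∀ cb : PBond (F.P K) (K - n), g (K - n) cb =
      Real.exp (-(δ₀ / 2 * distSite (Mk (F.P K) (K - n)) (iterBlockOf (K - n) b.src) cb.src)) *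
        (distSite (Mk (F.P K) (K - n)) (iterBlockOf (K - n) b.src) cb.src + 1) := by
    intro cb
    rw [hg]
    simp only [hDk, Nat.sub_self, pow_zero, one_mul, mul_one]
  simp only [hg']
  -- sum over bonds = 3 × sum over sites; per-term bound; uniform lattice sum
  have hterm : ∀ cb : PBond (F.P K) (K - n),
      Real.exp (-(δ₀ / 2 * distSite (Mk (F.P K) (K - n)) (iterBlockOf (K - n) b.src) cb.src)) *
        (distSite (Mk (F.P K) (K - n)) (iterBlockOf (K - n) b.src) cb.src + 1) ≤
      (4 / δ₀ + 1) * Real.exp (-(δ₀ / 4 * distSite (Mk (F.P K) (K - n)) (iterBlockOf (K - n) b.src) cb.src)) :=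
    fun cb => exp_mul_add_one_le hδ₀ (distSite_nonneg _ _)
  refine (Finset.sum_le_sum fun cb _ => hterm cb).trans ?_
  set Hf : Site (F.P K) (K - n) → ℝ := fun y =>
    (4 / δ₀ + 1) * Real.exp (-(δ₀ / 4 * distSite (Mk (F.P K) (K - n)) (iterBlockOf (K - n) b.src) y)) with hHf
  have heqv : ∑ cb : PBond (F.P K) (K - n), Hf cb.src = ∑ p : Site (F.P K) (K - n) × Fin (F.P K).d, Hf p.1 :=
    Fintype.sum_equiv (⟨fun cb => (cb.src, cb.dir), fun p => ⟨p.1, p.2⟩, fun _ => rfl, fun _ => rfl⟩ :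
      PBond (F.P K) (K - n) ≃ Site (F.P K) (K - n) × Fin (F.P K).d) (fun cb => Hf cb.src) (fun p => Hf p.1) (fun _ => rfl)
  have hprod : ∑ p : Site (F.P K) (K - n) × Fin (F.P K).d, Hf p.1 = 3 * ∑ y : Site (F.P K) (K - n), Hf y := by
    rw [Fintype.sum_prod_type, Finset.mul_sum]
    refine Finset.sum_congr rfl fun y _ => ?_
    change ∑ _l : Fin 3, Hf y = 3 * Hf y
    rw [Finset.sum_const, Finset.card_univ, Fintype.card_fin, nsmul_eq_mul]
    norm_num
  change ∑ cb : PBond (F.P K) (K - n), Hf cb.src ≤ _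
  rw [heqv, hprod, hHf, ← Finset.mul_sum]
  have hK := sum_exp_distSite_le F K (K - n) (a := δ₀ / 4) (by positivity) (iterBlockOf (K - n) b.src)
  have h4 : (0 : ℝ) ≤ 4 / δ₀ + 1 := by positivity
  calc 3 * ((4 / δ₀ + 1) * ∑ y : Site (F.P K) (K - n), Real.exp (-(δ₀ / 4 * distSite (Mk (F.P K) (K - n)) (iterBlockOf (K - n) b.src) y)))
      ≤ 3 * ((4 / δ₀ + 1) * latticeConst 3 (δ₀ / 4)) := by gcongr
    _ = 3 * (4 / δ₀ + 1) * latticeConst 3 (δ₀ / 4) := by ring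

/-! ## §2 The one-level witness modulo the second-order kernel rows of `H` -/

/-- **`RowsAt` AT THE ONE-LEVEL FAMILY `Domains.whole (K − n)`, MODULO THE SECOND-ORDER KERNEL ROWS OF `H`**: for odd `L > 1` there is `C_G > 0` such that for every
member `F.L = L`, heights `n < K`, P2 weights `w`, and constant `C′ ≥ 0`: IF the canonical `flatH` of `whole (K−n)` satisfies (k3) and (k4) at the rate `κ₁₆₃(3)/3` over
`distBI` with constant `C′`, THEN `RowsAt F n K (whole (K−n)) w B₀ (κ₁₆₃(3)/3) B₃ C_G 1` with `B₀ = max C (C·B₃)`, `C = max (max C₀ C₁) C′` (p1 g14's `C₀ = MG163·C_per`,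
`C₁ = MD163·C_per`), `B₃ = 3(4/κ + 1)K₃(κ/4)`.  Everything except (k3), (k4) is discharged: (k1), (k2) `hKernelRows12_whole`, (162) `rowSum162_whole`, the `G`-rows
`gRows_whole`, the `Q`-row `qContrLetter_whole`. [cite: Balaban1985Variational, (46) p.285, (130) p.298, (139)-(140) p.299, (161)-(163) p.303; Balaban1984PropagatorsII, Cor. 2.8 p.249; Balaban1984PropagatorsI, (1.63)-(1.66) p.29, (1.115) p.36] -/
theorem rowsAt_whole_of_secondOrderRows (L : ℕ) (hL : Odd L ∧ 1 < L) :
    ∃ CG : ℝ, 0 < CG ∧ ∀ (F : T3Family), F.L = L → ∀ (n K : ℕ), n < K →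
      ∀ (w : ℕ → PBond (F.P K) 0 → ℝ), IsLevWeight F n K (Domains.whole (K - n) (le_T3 F n K)) w →
      ∀ (C' : ℝ), 0 ≤ C' →
      (∀ (c : BondIdx (Domains.whole (K - n) (le_T3 F n K) : Domains (F.P K))) (e : BondIdx (Domains.whole (K - n) (le_T3 F n K) : Domains (F.P K)) → ℝ),
          e c = 1 → (∀ c', c' ≠ c → e c' = 0) → ∀ b : PBond (F.P K) 0,
          w 3 b * |(dcsE ((F.L : ℝ) ^ (K - n)) (dcE ((F.L : ℝ) ^ (K - n))
              (WithLp.toLp 2 (flatH F n K (Domains.whole (K - n) (le_T3 F n K)) e)))) b| ≤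
            C' * Real.exp (-(kappa163 3 / 3 * distBI (Domains.whole (K - n) (le_T3 F n K)) b c)) ∧
          w 2 b * ((F.L : ℝ) ^ (K - n)) ^ 2 *
              |∑ ν : Fin 3, ((flatH F n K (Domains.whole (K - n) (le_T3 F n K)) e b -
                  flatH F n K (Domains.whole (K - n) (le_T3 F n K)) e ⟨b.src.shift ν, b.dir⟩) +
                (flatH F n K (Domains.whole (K - n) (le_T3 F n K)) e b -
                  flatH F n K (Domains.whole (K - n) (le_T3 F n K)) e ⟨b.src.unshift ν, b.dir⟩))| ≤
            C' * Real.exp (-(kappa163 3 / 3 * distBI (Domains.whole (K - n) (le_T3 F n K)) b c))) →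
      RowsAt F n K (Domains.whole (K - n) (le_T3 F n K)) w
        (max (max (max (MG163 3 * periodConst (kappa163 3) (3 - 1)) (MD163 3 * periodConst (kappa163 3) (3 - 1))) C')
          (max (max (MG163 3 * periodConst (kappa163 3) (3 - 1)) (MD163 3 * periodConst (kappa163 3) (3 - 1))) C' *
            (3 * (4 / (kappa163 3 / 3) + 1) * latticeConst 3 (kappa163 3 / 3 / 4))))
        (kappa163 3 / 3) (3 * (4 / (kappa163 3 / 3) + 1) * latticeConst 3 (kappa163 3 / 3 / 4)) CG 1 := by
  obtain ⟨CG, hCG, hG⟩ := gRows_whole L hL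
  refine ⟨CG, hCG, fun F hF n K hnK w hw C' hC' h34 => ?_⟩
  have hκ : 0 < kappa163 3 / 3 := div_pos (B5Hk163Strip.kappa163_pos 3) (by norm_num)
  set C₀ := MG163 3 * periodConst (kappa163 3) (3 - 1) with hC₀
  set C₁ := MD163 3 * periodConst (kappa163 3) (3 - 1) with hC₁
  set C := max (max C₀ C₁) C' with hCdef
  have hC : 0 ≤ C := le_trans hC' (le_max_right _ _)
  -- the four kernel rows for `flatH (whole (K−n))` over `distBI`
  have hk : HKernelRows F n K (Domains.whole (K - n) (le_T3 F n K)) (fun b c => distBI (Domains.whole (K - n) (le_T3 F n K)) b c) w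
      (flatH F n K (Domains.whole (K - n) (le_T3 F n K))) C (kappa163 3 / 3) := by
    intro c e he he' b
    obtain ⟨h1, h2⟩ := hKernelRows12_whole F n K w hw c e he he' b
    obtain ⟨h3, h4⟩ := h34 c e he he' b
    have hE : 0 ≤ Real.exp (-(kappa163 3 / 3 * distBI (Domains.whole (K - n) (le_T3 F n K)) b c)) := (Real.exp_pos _).le
    have hC₀C : C₀ ≤ C := (le_max_left _ _).trans (le_max_left _ _)
    have hC₁C : C₁ ≤ C := (le_max_right _ _).trans (le_max_left _ _)
    have hC'C : C' ≤ C := le_max_right _ _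
    exact ⟨h1.trans (mul_le_mul_of_nonneg_right hC₀C hE), fun ν => (h2 ν).trans (mul_le_mul_of_nonneg_right hC₁C hE),
      h3.trans (mul_le_mul_of_nonneg_right hC'C hE), h4.trans (mul_le_mul_of_nonneg_right hC'C hE)⟩
  have hrow := rowSum162_whole F n K hκ w hw
  obtain ⟨hs, hl, hcomp, hr, hd⟩ := hRows_of_kernelRows hw rfl hC (by linarith : kappa163 3 / 3 / 2 ≤ kappa163 3 / 3) (fun b c => le_rfl) hk hrow
  obtain ⟨w', hw', G, hGpin, hGs, hGl⟩ := hG F hF n K hnK w hw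
  exact ⟨⟨hs, hl, _, hcomp, hr, hd⟩, ⟨w', hw', G, hGpin, hGs, hGl⟩, qContrLetter_whole F n K (le_T3 F n K) w hw⟩

end Summit.QuantumFields.YangMills.Theorems.FlatRowsWhole

end
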